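import Literature.NumberTheory.LFunctions.PrimeLogSeries
import Literature.NumberTheory.LFunctions.MertensTail
import HarnessLib

/-!
# Two prime-sum inputs for partial Euler products: `∑_p p^{-1-u} = log(1/u) + O(1)` and
# `∑_{p ≤ x} 1/p = log log x + O(1)`

Topic `Literature/NumberTheory/LFunctions` (trunk T-ANT). The two classical estimates on sums
over primes that enter the `O(1)`-form of K. Conrad's Theorem 5.3 (*Partial Euler products on
the critical line*, Canad. J. Math. **57** (2005); there in the sharper forms with constants,
Lemma 5.1 `s ∫_e^∞ (log log x) x^{-s-1} dx = -log s - γ + o(1)` and Mertens' theorem), in the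
bounded forms that the tree can supply:

* `exists_abs_tsum_primes_rpow_add_log_le` (**M1**): there is `M` with
  `|∑_p p^{-(1+u)} + log u| ≤ M` for all `u ∈ (0, 1]`. Proof: `∑_p -log(1 - p^{-(1+u)})
  = log ζ(1+u) = log (zetaOne u) - log u` with `zetaOne u = u ζ(1+u)` continuous and positive on
  `[0, 1]` (`Literature.NumberTheory.LFunctions.PrimeLogSeries`), and
  `0 ≤ -log(1-y) - y ≤ 2y²` for `0 ≤ y ≤ 1/2`.
* `exists_abs_sum_primesLE_inv_sub_loglog_le` (**M2**, Mertens' second theorem in bounded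
  two-sided form): there is `M` with `|∑_{p ≤ N} 1/p - log log N| ≤ M` for all `N ≥ 2`
  (`Literature.NumberTheory.LFunctions.MertensBound.sum_inv_prime_le`, `Literature.NumberTheory.LFunctions.MertensBound.loglog_sub_loglog_le_sum_inv_prime`).

Both are folklore (Mertens 1874; Hardy–Wright Thms. 427–429; for M1 e.g. Montgomery–Vaughan,
*Multiplicative Number Theory I*, §1.3); they are proved here, not cited as facts.

## References

* K. Conrad, *Partial Euler products on the critical line*, Canad. J. Math. 57 (2005) 267–297,
  Lemma 5.1 and proof of Thm. 5.3. [cite: Conrad2005PartialEuler]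
* G. H. Hardy, E. M. Wright, *An Introduction to the Theory of Numbers*, 6th ed., Thm. 427.
  [cite: HardyWright2008]
-/

noncomputable section

open scoped Topology
open Filter Finset Complex Literature.NumberTheory.LFunctions.Nicolas

namespace Literature.NumberTheory.LFunctions

namespace PartialEuler

/-! ### M1: `∑_p p^{-1-u} + log u` is bounded on `(0, 1]` -/

/-! Notation in the docstrings: `P(x) = ∑_p p^{-x}` is the (real) prime zeta function, written
out as `∑' p : Nat.Primes, (p : ℝ) ^ (-x)` in every statement (this proof file introduces no
definitions). -/

/-- For `0 ≤ y ≤ 1/2`: `|-log(1-y) - y| ≤ 2 y²` (Taylor). [folklore] -/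
theorem abs_neg_log_one_sub_sub_le {y : ℝ} (hy0 : 0 ≤ y) (hy : y ≤ 1 / 2) :
    |-Real.log (1 - y) - y| ≤ 2 * y ^ 2 := by
  have hy1 : |y| < 1 := by rw [abs_of_nonneg hy0]; linarith
  have h := Real.abs_log_sub_add_sum_range_le hy1 1
  rw [abs_of_nonneg hy0] at h
  norm_num at h
  have h2 : y ^ 2 / (1 - y) ≤ 2 * y ^ 2 := by
    rw [div_le_iff₀ (by linarith)]
    nlinarith [mul_nonneg (sq_nonneg y) (show (0 : ℝ) ≤ 1 - 2 * y by linarith)]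
  calc |-Real.log (1 - y) - y| = |y + Real.log (1 - y)| := by
        rw [← abs_neg]; ring_nf
    _ ≤ y ^ 2 / (1 - y) := h
    _ ≤ 2 * y ^ 2 := h2

/-- For a prime `p` and `x ≥ 1`: `0 ≤ p^{-x} ≤ 1/2`. [folklore] -/
theorem primes_rpow_neg_le_half (p : Nat.Primes) {x : ℝ} (hx : 1 ≤ x) :
    ((p : ℕ) : ℝ) ^ (-x) ≤ 1 / 2 := by
  have hp : (2 : ℝ) ≤ (p : ℕ) := by exact_mod_cast p.2.two_le
  calc ((p : ℕ) : ℝ) ^ (-x) ≤ (2 : ℝ) ^ (-x) :=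
        Real.rpow_le_rpow_of_nonpos (by norm_num) hp (by linarith)
    _ ≤ (2 : ℝ) ^ (-1 : ℝ) := Real.rpow_le_rpow_of_exponent_le (by norm_num) (by linarith)
    _ = 1 / 2 := by norm_num

/-- `|∑ f| ≤ ∑ |f|` for an absolutely summable real family. [folklore] -/
theorem abs_tsum_le_tsum_abs {ι : Type*} {f : ι → ℝ} (hf : Summable fun p => |f p|) :
    |∑' p, f p| ≤ ∑' p, |f p| := by
  have := norm_tsum_le_tsum_norm (f := f) (by simpa [Real.norm_eq_abs] using hf)
  simpa [Real.norm_eq_abs] using this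

/-- `|∑_p p^{-x} - ∑_p -log(1 - p^{-x})| ≤ 2 ∑_p p^{-2}` for `x > 1` (termwise Taylor bound
with `p^{-2x} ≤ p^{-2}`). [folklore] -/
theorem abs_tsum_primes_rpow_sub_tsum_neg_log_le {x : ℝ} (hx : 1 < x) :
    |∑' p : Nat.Primes, ((p : ℕ) : ℝ) ^ (-x) -
        ∑' p : Nat.Primes, -Real.log (1 - ((p : ℕ) : ℝ) ^ (-x))| ≤
      2 * ∑' p : Nat.Primes, ((p : ℕ) : ℝ) ^ (-2 : ℝ) := by
  have hs1 := summable_primes_rpow_neg hx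
  have hs2 : Summable fun p : Nat.Primes => ((p : ℕ) : ℝ) ^ (-2 : ℝ) :=
    Nat.Primes.summable_rpow.2 (by norm_num)
  -- the difference is termwise bounded by `2 p^{-2}`
  have hbd : ∀ p : Nat.Primes, |((p : ℕ) : ℝ) ^ (-x) - -Real.log (1 - ((p : ℕ) : ℝ) ^ (-x))| ≤
      2 * ((p : ℕ) : ℝ) ^ (-2 : ℝ) := by
    intro p
    have hp0 : (0 : ℝ) < (p : ℕ) := by exact_mod_cast p.2.pos
    have hy0 : 0 ≤ ((p : ℕ) : ℝ) ^ (-x) := by positivity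
    have hy := primes_rpow_neg_le_half p hx.le
    have h := abs_neg_log_one_sub_sub_le hy0 hy
    rw [abs_sub_comm] at h
    refine h.trans ?_
    have : (((p : ℕ) : ℝ) ^ (-x)) ^ 2 ≤ ((p : ℕ) : ℝ) ^ (-2 : ℝ) := by
      rw [← Real.rpow_natCast, ← Real.rpow_mul hp0.le]
      exact Real.rpow_le_rpow_of_exponent_le (by exact_mod_cast p.2.one_lt.le)
        (by push_cast; linarith)
    linarith
  have hs3 : Summable fun p : Nat.Primes =>
      ((p : ℕ) : ℝ) ^ (-x) - -Real.log (1 - ((p : ℕ) : ℝ) ^ (-x)) := by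
    refine Summable.of_norm_bounded (hs2.mul_left 2) fun p => ?_
    rw [Real.norm_eq_abs]
    exact hbd p
  have hs4 : Summable fun p : Nat.Primes => -Real.log (1 - ((p : ℕ) : ℝ) ^ (-x)) := by
    have := hs1.sub hs3
    simpa using this
  rw [← hs1.tsum_sub hs4, ← tsum_mul_left]
  refine (abs_tsum_le_tsum_abs hs3.abs).trans ?_
  exact hs3.abs.tsum_le_tsum (fun p => hbd p) (hs2.mul_left 2)

/-- `∑_p -log(1 - p^{-(1+u)}) = log (zetaOne u).re - log u` for `0 < u`: the Euler product
`exp (∑_p -log(1 - p^{-x})) = ζ(x)` (Mathlib) at `x = 1 + u`, and `u ζ(1+u) = zetaOne u > 0`.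
[folklore] -/
theorem tsum_neg_log_one_sub_primes_rpow_eq {u : ℝ} (hu : 0 < u) :
    ∑' p : Nat.Primes, -Real.log (1 - ((p : ℕ) : ℝ) ^ (-(1 + u))) =
      Real.log (zetaOne u).re - Real.log u := by
  set R : ℝ := ∑' p : Nat.Primes, -Real.log (1 - ((p : ℕ) : ℝ) ^ (-(1 + u))) with hR
  have hx : 1 < 1 + u := by linarith
  have h1 : primeZetaLog ((1 + u : ℝ) : ℂ) = (R : ℂ) := primeZetaLog_ofReal hx
  have h2 : exp (primeZetaLog ((1 + u : ℝ) : ℂ)) = riemannZeta ((1 + u : ℝ) : ℂ) :=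
    exp_primeZetaLog (by simp; linarith)
  obtain ⟨r, hr, hr'⟩ := zetaOne_ofReal_eq (σ := u) (by linarith)
  have hu0 : (u : ℂ) ≠ 0 := by exact_mod_cast hu.ne'
  have h3 : zetaOne u = u * riemannZeta (1 + u) := zetaOne_of_ne_zero hu0
  have h4 : riemannZeta ((1 + u : ℝ) : ℂ) = r / u := by
    push_cast
    rw [eq_div_iff hu0, mul_comm, ← h3, hr']
  rw [h1, h4] at h2
  -- `exp R = r / u` as real numbers
  have h5 : Real.exp R = r / u := by
    have : ((Real.exp R : ℝ) : ℂ) = ((r / u : ℝ) : ℂ) := by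
      rw [ofReal_exp, h2]
      push_cast
      rfl
    exact_mod_cast this
  have h6 : R = Real.log r - Real.log u := by
    rw [← Real.log_div hr.ne' hu.ne', ← h5, Real.log_exp]
  have h7 : (zetaOne u).re = r := by rw [hr', ofReal_re]
  rw [h7]
  exact h6

/-- `log (zetaOne u).re` is bounded for `u ∈ [0, 1]`: `zetaOne` is continuous and positive real
on the real segment `[-1/2, ∞)`, so its real part attains a positive minimum and a maximum on
the compact `[0, 1]`. [folklore] -/
theorem exists_abs_log_zetaOne_re_le :
    ∃ M : ℝ, ∀ u ∈ Set.Icc (0 : ℝ) 1, |Real.log (zetaOne u).re| ≤ M := by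
  have hcont : ContinuousOn (fun u : ℝ => (zetaOne u).re) (Set.Icc 0 1) :=
    (continuous_re.comp (continuous_zetaOne.comp continuous_ofReal)).continuousOn
  have hpos : ∀ u ∈ Set.Icc (0 : ℝ) 1, 0 < (zetaOne u).re := by
    intro u hu
    obtain ⟨r, hr, hr'⟩ := zetaOne_ofReal_eq (σ := u) (by linarith [hu.1])
    rw [hr', ofReal_re]
    exact hr
  obtain ⟨u₀, hu₀, hmin⟩ := isCompact_Icc.exists_isMinOn (Set.nonempty_Icc.mpr zero_le_one) hcont
  obtain ⟨u₁, hu₁, hmax⟩ := isCompact_Icc.exists_isMaxOn (Set.nonempty_Icc.mpr zero_le_one) hcont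
  refine ⟨max |Real.log (zetaOne u₀).re| |Real.log (zetaOne u₁).re|, fun u hu => ?_⟩
  have hlo : Real.log (zetaOne u₀).re ≤ Real.log (zetaOne u).re :=
    Real.log_le_log (hpos u₀ hu₀) (hmin hu)
  have hhi : Real.log (zetaOne u).re ≤ Real.log (zetaOne u₁).re :=
    Real.log_le_log (hpos u hu) (hmax hu)
  rw [abs_le]
  constructor
  · have := neg_abs_le (Real.log (zetaOne (u₀ : ℂ)).re)
    linarith [le_max_left |Real.log (zetaOne (u₀ : ℂ)).re| |Real.log (zetaOne (u₁ : ℂ)).re|]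
  · have := le_abs_self (Real.log (zetaOne (u₁ : ℂ)).re)
    linarith [le_max_right |Real.log (zetaOne (u₀ : ℂ)).re| |Real.log (zetaOne (u₁ : ℂ)).re|]

/-- **M1.** There is a constant `M` such that `|∑_p p^{-(1+u)} + log u| ≤ M` for all
`u ∈ (0, 1]`: the prime zeta function satisfies `P(1+u) = log (1/u) + O(1)` as `u → 0⁺`
(the logarithmic singularity of `log ζ(s)` at `s = 1`; Conrad's Lemma 5.1 is the refined form
with the constant). [cite: Conrad2005PartialEuler, Lemma 5.1 and proof of Thm. 5.3] -/
theorem exists_abs_tsum_primes_rpow_add_log_le :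
    ∃ M : ℝ, ∀ u ∈ Set.Ioc (0 : ℝ) 1,
      |∑' p : Nat.Primes, ((p : ℕ) : ℝ) ^ (-(1 + u)) + Real.log u| ≤ M := by
  obtain ⟨M₀, hM₀⟩ := exists_abs_log_zetaOne_re_le
  refine ⟨M₀ + 2 * ∑' p : Nat.Primes, ((p : ℕ) : ℝ) ^ (-2 : ℝ), fun u hu => ?_⟩
  have h1 := abs_tsum_primes_rpow_sub_tsum_neg_log_le (x := 1 + u) (by linarith [hu.1])
  have h2 := tsum_neg_log_one_sub_primes_rpow_eq hu.1
  have h3 := hM₀ u ⟨hu.1.le, hu.2⟩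
  rw [h2] at h1
  set P : ℝ := ∑' p : Nat.Primes, ((p : ℕ) : ℝ) ^ (-(1 + u)) with hP
  calc |P + Real.log u|
      = |(P - (Real.log (zetaOne u).re - Real.log u)) + Real.log (zetaOne u).re| := by ring_nf
    _ ≤ |P - (Real.log (zetaOne u).re - Real.log u)| +
          |Real.log (zetaOne u).re| := abs_add_le _ _
    _ ≤ 2 * ∑' p : Nat.Primes, ((p : ℕ) : ℝ) ^ (-2 : ℝ) + M₀ := add_le_add h1 h3
    _ = M₀ + 2 * ∑' p : Nat.Primes, ((p : ℕ) : ℝ) ^ (-2 : ℝ) := by ring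

/-! ### M2: Mertens' second theorem, bounded two-sided form -/

/-- **M2** (Mertens 1874; Hardy–Wright Thm. 427: `∑_{p ≤ x} 1/p = log log x + B₁ + o(1)`),
in the bounded form: there is `M` with `|∑_{p ≤ N} 1/p - log log N| ≤ M` for every `N ≥ 2`
(upper half `Literature.NumberTheory.LFunctions.MertensBound.sum_inv_prime_le`, lower half from the tail bound
`Literature.NumberTheory.LFunctions.MertensBound.loglog_sub_loglog_le_sum_inv_prime` with `P = 2`).
[cite: HardyWright2008, Thm 427 (§22.7)] -/
theorem exists_abs_sum_primesLE_inv_sub_loglog_le :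
    ∃ M : ℝ, ∀ N : ℕ, 2 ≤ N →
      |∑ p ∈ Nat.primesLE N, (1 : ℝ) / p - Real.log (Real.log N)| ≤ M := by
  refine ⟨max 4 (|Real.log (Real.log 2)| + 6 / Real.log 2), fun N hN => ?_⟩
  have hup := Literature.NumberTheory.LFunctions.MertensBound.sum_inv_prime_le N hN
  have hN' : (2 : ℝ) ≤ N := by exact_mod_cast hN
  have hlow := Literature.NumberTheory.LFunctions.MertensBound.loglog_sub_loglog_le_sum_inv_prime (P := 2) (Q := N) le_rfl hN'
  have hsub : (Ioc ⌊(2 : ℝ)⌋₊ ⌊(N : ℝ)⌋₊).filter Nat.Prime ⊆ Nat.primesLE N := by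
    intro p hp
    simp only [Finset.mem_filter, Finset.mem_Ioc, Nat.floor_natCast] at hp
    exact Nat.mem_primesLE.mpr ⟨hp.1.2, hp.2⟩
  have hle : ∑ p ∈ (Ioc ⌊(2 : ℝ)⌋₊ ⌊(N : ℝ)⌋₊).filter Nat.Prime, (1 : ℝ) / p ≤
      ∑ p ∈ Nat.primesLE N, (1 : ℝ) / p :=
    Finset.sum_le_sum_of_subset_of_nonneg hsub fun p _ _ => by positivity
  have habs := le_abs_self (Real.log (Real.log 2))
  rw [abs_le]
  constructor
  · calc -max 4 (|Real.log (Real.log 2)| + 6 / Real.log 2)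
        ≤ -(|Real.log (Real.log 2)| + 6 / Real.log 2) := neg_le_neg (le_max_right _ _)
      _ ≤ _ := by linarith
  · calc ∑ p ∈ Nat.primesLE N, (1 : ℝ) / p - Real.log (Real.log N) ≤ 4 := by linarith
      _ ≤ _ := le_max_left _ _

/-- The same with the primes `≤ N` written as `(Finset.Iic N).filter Nat.Prime`, the finset of
`Literature.PartialEuler.primesLE` at a natural number. [cite: HardyWright2008, Thm 427 (§22.7)] -/
theorem exists_abs_sum_filter_prime_Iic_inv_sub_loglog_le :
    ∃ M : ℝ, ∀ N : ℕ, 2 ≤ N →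
      |∑ p ∈ (Finset.Iic N).filter Nat.Prime, (1 : ℝ) / p - Real.log (Real.log N)| ≤ M := by
  obtain ⟨M, hM⟩ := exists_abs_sum_primesLE_inv_sub_loglog_le
  refine ⟨M, fun N hN => ?_⟩
  have : (Finset.Iic N).filter Nat.Prime = Nat.primesLE N := by
    ext p
    simp [Nat.mem_primesLE]
  rw [this]
  exact hM N hN

end PartialEuler

end Literature.NumberTheory.LFunctions

end
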